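import Summits.BirchSwinnertonDyer.Rank2.ThreeDescentTripleKernel
import Literature.NumberTheory.EllipticCurves.Rank1Residual.X11RankOneCertificates.Minimality
import Literature.NumberTheory.EllipticCurves.ComplexMultiplicationLocalFactorsAux
import Literature.NumberTheory.EllipticCurves.PointCountEulerCriterion
import Literature.NumberTheory.EllipticCurves.SelmerCorankHolds
import Literature.NumberTheory.EllipticCurves.PAdicLFunction
import Summits.BirchSwinnertonDyer.Rank2.ParitySqueezeKernel
import HarnessLib

/-!
# The door-(F*) configuration IN MINIATURE: `corank_{ℤ₂} Sel_{2^∞}(E₀/ℚ) = ord_{T=0} L₂(E₀,T) = 3`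
# for the RANK-THREE curve `E₀ : y² + xy = x³ + 4x² + 105x` (conductor `675255 = 3·5·7·59·109`),
# with the Mordell–Weil input `rank E₀(ℚ) ≥ 3` PROVED by a kernel-decided `3`-descent

Cell `bsd-rank2` (D-0036, attack on the `r_an ≥ 2` rung), seat `bsd-rank2-eng-2` GEN 4, for planner
`bsd-rank2-p2` GEN 14 (memo `run/shared/lean/pub/bsd-rank2/p2/PADIC-R2-G14.md` §4.4 «BC5 witness of
weakness», sketch `p2/g14/Toy675255.lean`, eng ask §6.2 (d)) under director-bsd's ruling
2026-08-27T04:43:36Z (5): «eng: land the BC5 toy `Toy675255` (corank = ord L₂ = 3 on [1,4,0,105,0]) as a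
Rank2 Theorems file NOW, independent of the route — GO». Route context: `TwoAdicLambdaTransport`
(door token «T-r3₂», leaf `Rank2.Family81517.SelmerCorankEqOrderEqThreeOnOddFamily`): the leaf
configuration `(s, s′; λ) = (3, 1; 4)` on ONE explicit curve where the analytic `λ`-count is a finite
computation.

## Content (THEOREMS ONLY — no definition, no named fact, no `sorry`; axioms `propext`,
## `Classical.choice`, `Quot.sound`)

* §1 = companion file `Rank2/ThreeDescentTripleKernel.lean` (pure group theory:
  `linearIndependent_triple_of_three_descent` — in an abelian group without `3`-torsion three elements
  are `ℤ`-independent once none of the thirteen representatives of `ℙ²(𝔽₃)` lies in `3M` —,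
  `not_three_dvd_of_cert`, `three_le_mordellWeilRank_of_linearIndependent`).
* §2 NUMERICS OF `E₀ = [1, 4, 0, 105, 0]` (integer model; `Δ = −70901775 = −3²·5²·7²·59·109`): the
  rational points `P₁ = (1,10)`, `P₂ = (3,18)`, `P₃ = (5,25)`; the reduction homomorphisms at the good
  primes `11, 13, 23, 37` with the images of `P₁, P₂, P₃` (`toy_exists_red`, from
  `Theorems.intModel_exists_reductionHom`); `#Ẽ₀(𝔽₁₁) = 12`, `#Ẽ₀(𝔽₁₃) = 16`, `#Ẽ₀(𝔽₂₃) = 24`,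
  `#Ẽ₀(𝔽₃₇) = 48` and the thirteen certificates `(#Ẽ/3) • ū ≠ Õ` (nine at `11`, three at `23`, one at
  `37`) — all by `decide +kernel` on Mathlib's group law over `ZMod ℓ`.
* §3 `toy_isElliptic`; `toy_isGloballyMinimal` (`v_ℓ(Δ) < 12`, tree `isGloballyMinimal_of_int_criterion`);
  `toy_no_three_torsion` (reduction at `13` is injective on prime-to-`13` torsion, `3 ∤ 16`);
  `toy_linearIndependent`; **`toy_three_le_mordellWeilRank : 3 ≤ rank E₀(ℚ)`** (Mordell–Weil by the tree
  theorem `module_finite_point_holds`).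
* §4 **`toy_selmerCorank_eq_order_eq_three`** — p2's `toy_corank_eq_order_eq_three` with `ToyFacts`
  DISCHARGED: from (hK) Kato's divisibility at `p = 2` for `E₀` (`corank Sel_{2^∞} ≤ ord_T L₂(f, α₂;T)`
  for every newform `f` of `E₀`; Kato 2004 Thm. 17.4/18.4 — a hypothesis, the tree's Kato facts are
  vendored with `p ≠ 2`), (hC) the ANALYTIC CERTIFICATE (some nonzero multiple `g ∈ ℤ₂⟦T⟧` of `L₂` is
  divisible by `T + 2` — the Mazur–Tate–Teitelbaum zero at the conductor-`8` character, `w(E₀ ⊗ χ₈) =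
  −1` — and has a unit coefficient in degree `≤ 4`; a finite `2`-adic modular-symbol computation,
  numerically `λ = 4, μ = 0`, kit j265726 of p2 G13; NOT certified here) and (hmod) modularity, conclude
  `corank_{ℤ₂} Sel_{2^∞}(E₀/ℚ) = 3` and `ord_{T=0} L₂(f, α₂; T) = 3` for every newform — by the landed
  `Rank2.paritySqueezeKernel` (`3 ≤ rank ≤ corank ≤ ord`, and `ord = 3` from the certificate).

PARTITION: none — r_an ≥ 2, summit axis S0 (D-0036(1) funded rung); TWIN (D-0056): n/a. B1 honesty: a
single-curve statement in Selmer-corank / order currency, conditional on Kato at `2`, one finite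
certificate and modularity (all hypotheses, displayed); `rank ≥ 3` and the model facts are
unconditional theorems; nothing reads an analytic rank; no Mordell–Weil rank `= 3`, no finiteness of
`Ш`, no S0 motion.

References: K. Kato, *Astérisque* 295 (2004), Thm. 17.4 / 18.4 [Kato2004Asterisque]; B. Mazur, J. Tate,
J. Teitelbaum, *Invent. Math.* 84 (1986) §I.14 [MazurTateTeitelbaum1986Invent]; J. H. Silverman, *AEC*
(2009) VII Remark 1.1, VII.2.1, VII.3.1(b), VIII.6.7 [SilvermanAEC2009]; J. W. S. Cassels, *LEC* (1991)
§13 (descent by a prime) [folklore]; planner memo PADIC-R2-G14 §4.4 (kit j265726, j268400).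
-/


set_option linter.dupNamespace false

noncomputable section

open scoped Classical
open WeierstrassCurve Literature.NumberTheory.EllipticCurves
  Summit.BirchSwinnertonDyer.BirchSwinnertonDyer.Theorems

namespace Summit.BirchSwinnertonDyer.Rank2

/-! ### §2 The curve `E₀ = [1, 4, 0, 105, 0]`: discriminant, reductions at `11, 13, 23, 37`, certificates -/

/-- `Δ(E₀) = −70901775 = −3²·5²·7²·59·109` for `E₀ : y² + xy = x³ + 4x² + 105x`. [folklore] -/
theorem toyInt_Δ : (⟨1, 4, 0, 105, 0⟩ : WeierstrassCurve ℤ).Δ = -70901775 := by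
  simp [WeierstrassCurve.Δ, WeierstrassCurve.b₂, WeierstrassCurve.b₄, WeierstrassCurve.b₆,
    WeierstrassCurve.b₈]

/-- The rational model `⟨1, 4, 0, 105, 0⟩ / ℚ` is the base change of the integer model. [folklore] -/
theorem toyInt_map_eq :
    (⟨1, 4, 0, 105, 0⟩ : WeierstrassCurve ℤ).map (Int.castRingHom ℚ) = ⟨1, 4, 0, 105, 0⟩ := by
  ext <;> simp [WeierstrassCurve.map]

/-- `Δ(E₀/ℚ) ≠ 0`. [folklore] -/
theorem toy_map_Δ_ne_zero :
    ((⟨1, 4, 0, 105, 0⟩ : WeierstrassCurve ℤ).map (Int.castRingHom ℚ)).Δ ≠ 0 := by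
  rw [WeierstrassCurve.map_Δ, toyInt_Δ]; norm_num

/-- `P₁ = (1, 10) ∈ E₀(ℚ)` (`100 + 10 = 1 + 4 + 105`). [folklore] -/
theorem toy_nonsingular_P₁ :
    ((⟨1, 4, 0, 105, 0⟩ : WeierstrassCurve ℤ).map (Int.castRingHom ℚ)).toAffine.Nonsingular
      ((1 : ℤ) : ℚ) ((10 : ℤ) : ℚ) :=
  (Affine.equation_iff_nonsingular_of_Δ_ne_zero toy_map_Δ_ne_zero).mp
    (by rw [toyInt_map_eq, Affine.equation_iff]; norm_num)

/-- `P₂ = (3, 18) ∈ E₀(ℚ)` (`324 + 54 = 27 + 36 + 315`). [folklore] -/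
theorem toy_nonsingular_P₂ :
    ((⟨1, 4, 0, 105, 0⟩ : WeierstrassCurve ℤ).map (Int.castRingHom ℚ)).toAffine.Nonsingular
      ((3 : ℤ) : ℚ) ((18 : ℤ) : ℚ) :=
  (Affine.equation_iff_nonsingular_of_Δ_ne_zero toy_map_Δ_ne_zero).mp
    (by rw [toyInt_map_eq, Affine.equation_iff]; norm_num)

/-- `P₃ = (5, 25) ∈ E₀(ℚ)` (`625 + 125 = 125 + 100 + 525`). [folklore] -/
theorem toy_nonsingular_P₃ :
    ((⟨1, 4, 0, 105, 0⟩ : WeierstrassCurve ℤ).map (Int.castRingHom ℚ)).toAffine.Nonsingular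
      ((5 : ℤ) : ℚ) ((25 : ℤ) : ℚ) :=
  (Affine.equation_iff_nonsingular_of_Δ_ne_zero toy_map_Δ_ne_zero).mp
    (by rw [toyInt_map_eq, Affine.equation_iff]; norm_num)

/-- `11, 13, 23, 37` are good primes of `E₀` (`Δ = −3²·5²·7²·59·109`). [folklore] -/
theorem toy_good_primes :
    ¬ ((11 : ℤ) ∣ (⟨1, 4, 0, 105, 0⟩ : WeierstrassCurve ℤ).Δ) ∧
    ¬ ((13 : ℤ) ∣ (⟨1, 4, 0, 105, 0⟩ : WeierstrassCurve ℤ).Δ) ∧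
    ¬ ((23 : ℤ) ∣ (⟨1, 4, 0, 105, 0⟩ : WeierstrassCurve ℤ).Δ) ∧
    ¬ ((37 : ℤ) ∣ (⟨1, 4, 0, 105, 0⟩ : WeierstrassCurve ℤ).Δ) := by
  rw [toyInt_Δ]; norm_num

/-- **The reduction of `E₀` at a good prime `ℓ`, with the images of `P₁, P₂, P₃`** (the companion
kernel `Theorems.intModel_exists_reductionHom`: a homomorphism `E₀(ℚ) → Ẽ₀(𝔽_ℓ)` sending integral
points to their residues). [cite: SilvermanAEC2009, Prop. VII.2.1] -/
theorem toy_exists_red (ℓ : ℕ) [Fact ℓ.Prime]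
    (hΔ : ¬ ((ℓ : ℤ) ∣ (⟨1, 4, 0, 105, 0⟩ : WeierstrassCurve ℤ).Δ)) :
    ∃ red : ((⟨1, 4, 0, 105, 0⟩ : WeierstrassCurve ℤ).map (Int.castRingHom ℚ)).toAffine.Point →+
        ((⟨1, 4, 0, 105, 0⟩ : WeierstrassCurve ℤ).map (Int.castRingHom (ZMod ℓ))).toAffine.Point,
      (∀ (n : ℤ), ¬ ((ℓ : ℤ) ∣ n) →
        ∀ P : ((⟨1, 4, 0, 105, 0⟩ : WeierstrassCurve ℤ).map (Int.castRingHom ℚ)).toAffine.Point,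
          n • P = 0 → red P = 0 → P = 0) ∧
      red (.some _ _ toy_nonsingular_P₁) = .some _ _
        (intModel_nonsingular_reduce _ ℓ hΔ 1 10 toy_nonsingular_P₁) ∧
      red (.some _ _ toy_nonsingular_P₂) = .some _ _
        (intModel_nonsingular_reduce _ ℓ hΔ 3 18 toy_nonsingular_P₂) ∧
      red (.some _ _ toy_nonsingular_P₃) = .some _ _
        (intModel_nonsingular_reduce _ ℓ hΔ 5 25 toy_nonsingular_P₃) := by
  obtain ⟨red, hsome, hinj⟩ := intModel_exists_reductionHom (⟨1, 4, 0, 105, 0⟩ : WeierstrassCurve ℤ) ℓ hΔ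
  exact ⟨red, hinj, hsome 1 10 _ _, hsome 3 18 _ _, hsome 5 25 _ _⟩

/-- `#Ẽ₀(𝔽₁₁) = 12` (kernel-decided). [folklore] -/
theorem card_toy_eleven :
    Nat.card (((⟨1, 4, 0, 105, 0⟩ : WeierstrassCurve ℤ).map
      (Int.castRingHom (ZMod 11))).toAffine.Point) = 12 := by
  rw [@WeierstrassCurve.natCard_point_eq_one_add_card (ZMod 11) (@ZMod.instField 11 ⟨by norm_num⟩) _ _ _
    (by decide +kernel), @card_sol_eq_sum_euler (ZMod 11) (@ZMod.instField 11 ⟨by norm_num⟩) _ _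
    (by rw [ZMod.ringChar_zmod_n]; decide), ZMod.card]
  decide +kernel

/-- `#Ẽ₀(𝔽₁₃) = 16` (kernel-decided; `3 ∤ 16`: no rational `3`-torsion). [folklore] -/
theorem card_toy_thirteen :
    Nat.card (((⟨1, 4, 0, 105, 0⟩ : WeierstrassCurve ℤ).map
      (Int.castRingHom (ZMod 13))).toAffine.Point) = 16 := by
  rw [@WeierstrassCurve.natCard_point_eq_one_add_card (ZMod 13) (@ZMod.instField 13 ⟨by norm_num⟩) _ _ _
    (by decide +kernel), @card_sol_eq_sum_euler (ZMod 13) (@ZMod.instField 13 ⟨by norm_num⟩) _ _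
    (by rw [ZMod.ringChar_zmod_n]; decide), ZMod.card]
  decide +kernel

/-- `#Ẽ₀(𝔽₂₃) = 24` (kernel-decided). [folklore] -/
theorem card_toy_twentythree :
    Nat.card (((⟨1, 4, 0, 105, 0⟩ : WeierstrassCurve ℤ).map
      (Int.castRingHom (ZMod 23))).toAffine.Point) = 24 := by
  rw [@WeierstrassCurve.natCard_point_eq_one_add_card (ZMod 23) (@ZMod.instField 23 ⟨by norm_num⟩) _ _ _
    (by decide +kernel), @card_sol_eq_sum_euler (ZMod 23) (@ZMod.instField 23 ⟨by norm_num⟩) _ _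
    (by rw [ZMod.ringChar_zmod_n]; decide), ZMod.card]
  decide +kernel

/-- `#Ẽ₀(𝔽₃₇) = 48` (kernel-decided). [folklore] -/
theorem card_toy_thirtyseven :
    Nat.card (((⟨1, 4, 0, 105, 0⟩ : WeierstrassCurve ℤ).map
      (Int.castRingHom (ZMod 37))).toAffine.Point) = 48 := by
  rw [@WeierstrassCurve.natCard_point_eq_one_add_card (ZMod 37) (@ZMod.instField 37 ⟨by norm_num⟩) _ _ _
    (by decide +kernel), @card_sol_eq_sum_euler (ZMod 37) (@ZMod.instField 37 ⟨by norm_num⟩) _ _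
    (by rw [ZMod.ringChar_zmod_n]; decide), ZMod.card]
  decide +kernel

/-- **The `𝔽₁₁` certificates** (`#Ẽ₀(𝔽₁₁) = 12`, test multiplier `4`): `4ū ≠ Õ` for the nine
representatives `P₁`, `P₂`, `P₁+P₂`, `P₁+P₃`, `P₁+2P₃`, `P₂+P₃`, `P₂+2P₃`, `P₁+P₂+P₃`, `P₁+P₂+2P₃`
(Mathlib's group law over `ZMod 11`, kernel-decided). [folklore] -/
theorem cert_toy_eleven [Fact (Nat.Prime 11)] :
    let P₁ : ((⟨1, 4, 0, 105, 0⟩ : WeierstrassCurve ℤ).map (Int.castRingHom (ZMod 11))).toAffine.Point :=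
      .some _ _ (intModel_nonsingular_reduce _ 11 toy_good_primes.1 1 10 toy_nonsingular_P₁)
    let P₂ : ((⟨1, 4, 0, 105, 0⟩ : WeierstrassCurve ℤ).map (Int.castRingHom (ZMod 11))).toAffine.Point :=
      .some _ _ (intModel_nonsingular_reduce _ 11 toy_good_primes.1 3 18 toy_nonsingular_P₂)
    let P₃ : ((⟨1, 4, 0, 105, 0⟩ : WeierstrassCurve ℤ).map (Int.castRingHom (ZMod 11))).toAffine.Point :=
      .some _ _ (intModel_nonsingular_reduce _ 11 toy_good_primes.1 5 25 toy_nonsingular_P₃)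
    (4 : ℕ) • P₁ ≠ 0 ∧ (4 : ℕ) • P₂ ≠ 0 ∧ (4 : ℕ) • (P₁ + P₂) ≠ 0 ∧ (4 : ℕ) • (P₁ + P₃) ≠ 0 ∧
    (4 : ℕ) • (P₁ + 2 • P₃) ≠ 0 ∧ (4 : ℕ) • (P₂ + P₃) ≠ 0 ∧ (4 : ℕ) • (P₂ + 2 • P₃) ≠ 0 ∧
    (4 : ℕ) • (P₁ + P₂ + P₃) ≠ 0 ∧ (4 : ℕ) • (P₁ + P₂ + 2 • P₃) ≠ 0 := by
  intro P₁ P₂ P₃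
  refine ⟨?_, ?_, ?_, ?_, ?_, ?_, ?_, ?_, ?_⟩ <;> decide +kernel +revert

/-- **The `𝔽₂₃` certificates** (`#Ẽ₀(𝔽₂₃) = 24`, multiplier `8`): `8ū ≠ Õ` for `P₃`, `P₁+2P₂+P₃`,
`P₁+2P₂+2P₃`. [folklore] -/
theorem cert_toy_twentythree [Fact (Nat.Prime 23)] :
    let P₁ : ((⟨1, 4, 0, 105, 0⟩ : WeierstrassCurve ℤ).map (Int.castRingHom (ZMod 23))).toAffine.Point :=
      .some _ _ (intModel_nonsingular_reduce _ 23 toy_good_primes.2.2.1 1 10 toy_nonsingular_P₁)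
    let P₂ : ((⟨1, 4, 0, 105, 0⟩ : WeierstrassCurve ℤ).map (Int.castRingHom (ZMod 23))).toAffine.Point :=
      .some _ _ (intModel_nonsingular_reduce _ 23 toy_good_primes.2.2.1 3 18 toy_nonsingular_P₂)
    let P₃ : ((⟨1, 4, 0, 105, 0⟩ : WeierstrassCurve ℤ).map (Int.castRingHom (ZMod 23))).toAffine.Point :=
      .some _ _ (intModel_nonsingular_reduce _ 23 toy_good_primes.2.2.1 5 25 toy_nonsingular_P₃)
    (8 : ℕ) • P₃ ≠ 0 ∧ (8 : ℕ) • (P₁ + 2 • P₂ + P₃) ≠ 0 ∧ (8 : ℕ) • (P₁ + 2 • P₂ + 2 • P₃) ≠ 0 := by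
  intro P₁ P₂ P₃
  refine ⟨?_, ?_, ?_⟩ <;> decide +kernel +revert

/-- **The `𝔽₃₇` certificate** (`#Ẽ₀(𝔽₃₇) = 48`, multiplier `16`): `16(P̄₁ + 2P̄₂) ≠ Õ`. [folklore] -/
theorem cert_toy_thirtyseven [Fact (Nat.Prime 37)] :
    let P₁ : ((⟨1, 4, 0, 105, 0⟩ : WeierstrassCurve ℤ).map (Int.castRingHom (ZMod 37))).toAffine.Point :=
      .some _ _ (intModel_nonsingular_reduce _ 37 toy_good_primes.2.2.2 1 10 toy_nonsingular_P₁)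
    let P₂ : ((⟨1, 4, 0, 105, 0⟩ : WeierstrassCurve ℤ).map (Int.castRingHom (ZMod 37))).toAffine.Point :=
      .some _ _ (intModel_nonsingular_reduce _ 37 toy_good_primes.2.2.2 3 18 toy_nonsingular_P₂)
    (16 : ℕ) • (P₁ + 2 • P₂) ≠ 0 := by
  intro P₁ P₂
  decide +kernel +revert

/-! ### §3 `E₀` is elliptic and globally minimal, `E₀(ℚ)` has no `3`-torsion, `rank E₀(ℚ) ≥ 3` -/

/-- `E₀ : y² + xy = x³ + 4x² + 105x` is an elliptic curve (`Δ = −70901775 ≠ 0`). [folklore] -/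
theorem toy_isElliptic : (⟨1, 4, 0, 105, 0⟩ : WeierstrassCurve ℚ).IsElliptic := by
  rw [← toyInt_map_eq]
  exact ⟨isUnit_iff_ne_zero.mpr toy_map_Δ_ne_zero⟩

/-- **`E₀ = [1, 4, 0, 105, 0]` is a global minimal model**: `v_ℓ(Δ) = v_ℓ(−3²·5²·7²·59·109) < 12` at
every prime (tree criterion `isGloballyMinimal_of_int_criterion`, Silverman *AEC* VII Remark 1.1).
[cite: SilvermanAEC2009, VII Remark 1.1] -/
theorem toy_isGloballyMinimal : (⟨1, 4, 0, 105, 0⟩ : WeierstrassCurve ℚ).IsGloballyMinimal := by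
  have e : (⟨1, 4, 0, 105, 0⟩ : WeierstrassCurve ℚ) =
      ⟨((1 : ℤ) : ℚ), ((4 : ℤ) : ℚ), ((0 : ℤ) : ℚ), ((105 : ℤ) : ℚ), ((0 : ℤ) : ℚ)⟩ := by
    ext <;> norm_num
  rw [e]
  refine Rank1Residual.X11RankOneCertificates.isGloballyMinimal_of_int_criterion 1 4 0 105 0
    fun q hq hboth ↦ ?_
  have h12 := hboth.1
  have hD : Rank1Residual.X11RankOneCertificates.discOf [1, 4, 0, 105, 0] = -70901775 := by decide
  rw [hD] at h12
  have hnat : q ^ 12 ∣ 70901775 := by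
    have h' : ((q ^ 12 : ℕ) : ℤ) ∣ (70901775 : ℕ) := by
      rw [Nat.cast_pow]; exact (dvd_neg.mp h12)
    exact Int.natCast_dvd_natCast.mp h'
  have hle : q ^ 12 ≤ 70901775 := Nat.le_of_dvd (by norm_num) hnat
  have hq5 : q < 5 := by
    by_contra h
    have h5 : 5 ^ 12 ≤ q ^ 12 := Nat.pow_le_pow_left (by omega) 12
    norm_num at h5
    omega
  interval_cases q <;> norm_num at hq <;> norm_num at hnat

/-- **`E₀(ℚ)` has no `3`-torsion**: the reduction at the good prime `13` is injective on prime-to-`13`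
torsion and `#Ẽ₀(𝔽₁₃) = 16` is prime to `3`. [cite: SilvermanAEC2009, Prop. VII.3.1(b)] -/
theorem toy_no_three_torsion
    (x : ((⟨1, 4, 0, 105, 0⟩ : WeierstrassCurve ℤ).map (Int.castRingHom ℚ)).toAffine.Point)
    (hx : (3 : ℤ) • x = 0) : x = 0 := by
  haveI : Fact (Nat.Prime 13) := ⟨by norm_num⟩
  obtain ⟨red, hinj, -, -, -⟩ := toy_exists_red 13 toy_good_primes.2.1
  refine hinj 3 (by decide) x hx ?_
  have hx' : (3 : ℕ) • x = 0 := by rw [ofNat_zsmul] at hx; exact hx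
  have h3 : addOrderOf (red x) ∣ 3 := by
    rw [addOrderOf_dvd_iff_nsmul_eq_zero, ← map_nsmul, hx', map_zero]
  have h16 : addOrderOf (red x) ∣ 16 := card_toy_thirteen ▸ addOrderOf_dvd_natCard (red x)
  have h1 : addOrderOf (red x) ∣ Nat.gcd 3 16 := Nat.dvd_gcd h3 h16
  norm_num at h1
  exact h1

/-- **`P₁ = (1,10)`, `P₂ = (3,18)`, `P₃ = (5,25)` are `ℤ`-linearly independent in `E₀(ℚ)`**: the
`3`-descent certificate `linearIndependent_triple_of_three_descent` on the reductions at `11`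
(nine representatives), `23` (three) and `37` (one); no `3`-torsion by `13`.
[cite: SilvermanAEC2009, Prop. VII.2.1 and Thm. VIII.6.7] -/
theorem toy_linearIndependent :
    LinearIndependent ℤ
      ![(Affine.Point.some _ _ toy_nonsingular_P₁ :
          ((⟨1, 4, 0, 105, 0⟩ : WeierstrassCurve ℤ).map (Int.castRingHom ℚ)).toAffine.Point),
        Affine.Point.some _ _ toy_nonsingular_P₂, Affine.Point.some _ _ toy_nonsingular_P₃] := by
  haveI : Fact (Nat.Prime 11) := ⟨by norm_num⟩
  haveI : Fact (Nat.Prime 23) := ⟨by norm_num⟩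
  haveI : Fact (Nat.Prime 37) := ⟨by norm_num⟩
  obtain ⟨r₁₁, -, h1a, h1b, h1c⟩ := toy_exists_red 11 toy_good_primes.1
  obtain ⟨r₂₃, -, h2a, h2b, h2c⟩ := toy_exists_red 23 toy_good_primes.2.2.1
  obtain ⟨r₃₇, -, h3a, h3b, -⟩ := toy_exists_red 37 toy_good_primes.2.2.2
  obtain ⟨c100, c010, c110, c101, c102, c011, c012, c111, c112⟩ := cert_toy_eleven
  obtain ⟨c001, c121, c122⟩ := cert_toy_twentythree
  have c120 := cert_toy_thirtyseven
  have d11 : 3 ∣ Nat.card (((⟨1, 4, 0, 105, 0⟩ : WeierstrassCurve ℤ).map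
      (Int.castRingHom (ZMod 11))).toAffine.Point) := by rw [card_toy_eleven]; norm_num
  have d23 : 3 ∣ Nat.card (((⟨1, 4, 0, 105, 0⟩ : WeierstrassCurve ℤ).map
      (Int.castRingHom (ZMod 23))).toAffine.Point) := by rw [card_toy_twentythree]; norm_num
  have d37 : 3 ∣ Nat.card (((⟨1, 4, 0, 105, 0⟩ : WeierstrassCurve ℤ).map
      (Int.castRingHom (ZMod 37))).toAffine.Point) := by rw [card_toy_thirtyseven]; norm_num
  refine linearIndependent_triple_of_three_descent toy_no_three_torsion _ _ _
    ?_ ?_ ?_ ?_ ?_ ?_ ?_ ?_ ?_ ?_ ?_ ?_ ?_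
  · exact not_three_dvd_of_cert r₁₁ d11 (by rw [card_toy_eleven, h1a]; exact c100)
  · exact not_three_dvd_of_cert r₁₁ d11 (by rw [card_toy_eleven, h1b]; exact c010)
  · exact not_three_dvd_of_cert r₂₃ d23 (by rw [card_toy_twentythree, h2c]; exact c001)
  · exact not_three_dvd_of_cert r₁₁ d11 (by rw [card_toy_eleven, map_add, h1a, h1b]; exact c110)
  · exact not_three_dvd_of_cert r₃₇ d37
      (by rw [card_toy_thirtyseven, map_add, map_nsmul, h3a, h3b]; exact c120)
  · exact not_three_dvd_of_cert r₁₁ d11 (by rw [card_toy_eleven, map_add, h1a, h1c]; exact c101)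
  · exact not_three_dvd_of_cert r₁₁ d11
      (by rw [card_toy_eleven, map_add, map_nsmul, h1a, h1c]; exact c102)
  · exact not_three_dvd_of_cert r₁₁ d11 (by rw [card_toy_eleven, map_add, h1b, h1c]; exact c011)
  · exact not_three_dvd_of_cert r₁₁ d11
      (by rw [card_toy_eleven, map_add, map_nsmul, h1b, h1c]; exact c012)
  · exact not_three_dvd_of_cert r₁₁ d11
      (by rw [card_toy_eleven, map_add, map_add, h1a, h1b, h1c]; exact c111)
  · exact not_three_dvd_of_cert r₁₁ d11
      (by rw [card_toy_eleven, map_add, map_add, map_nsmul, h1a, h1b, h1c]; exact c112)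
  · exact not_three_dvd_of_cert r₂₃ d23
      (by rw [card_toy_twentythree, map_add, map_add, map_nsmul, h2a, h2b, h2c]; exact c121)
  · exact not_three_dvd_of_cert r₂₃ d23
      (by rw [card_toy_twentythree, map_add, map_add, map_nsmul, map_nsmul, h2a, h2b, h2c]; exact c122)

/-- **`rank E₀(ℚ) ≥ 3`** (Mordell–Weil — tree theorem `module_finite_point_holds` — and three
independent points). [cite: SilvermanAEC2009, Thm. VIII.6.7] -/
theorem toy_three_le_mordellWeilRank : 3 ≤ (⟨1, 4, 0, 105, 0⟩ : WeierstrassCurve ℚ).mordellWeilRank := by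
  rw [← toyInt_map_eq]
  haveI : ((⟨1, 4, 0, 105, 0⟩ : WeierstrassCurve ℤ).map (Int.castRingHom ℚ)).IsElliptic :=
    ⟨isUnit_iff_ne_zero.mpr toy_map_Δ_ne_zero⟩
  -- the tree glue reads the group law through the classical `DecidableEq ℚ`: `convert`
  refine three_le_mordellWeilRank_of_linearIndependent _ (module_finite_point_holds _)
    (P := .some _ _ toy_nonsingular_P₁) (Q := .some _ _ toy_nonsingular_P₂)
    (R := .some _ _ toy_nonsingular_P₃) ?_
  convert toy_linearIndependent

/-! ### §4 The squeeze: `corank_{ℤ₂} Sel_{2^∞}(E₀/ℚ) = ord_{T=0} L₂(E₀, T) = 3` -/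

/-- **The door-(F*) configuration in miniature** (planner p2 G14 memo §4.4, BC5 witness of route
`TwoAdicLambdaTransport`): for the rank-three curve `E₀ = [1, 4, 0, 105, 0]` (conductor `675255`;
`rank E₀(ℚ) ≥ 3` PROVED above), Kato's divisibility at `p = 2` for `E₀` (`corank Sel_{2^∞} ≤ ord_T L₂`
for every newform of `E₀` — Kato 2004 Thm. 17.4/18.4, hypothesis `hK`), the ANALYTIC CERTIFICATE
(hypothesis `hC`: some nonzero multiple `g ∈ ℤ₂⟦T⟧` of `L₂(f, α₂; T)` is divisible by `T + 2` — the
Mazur–Tate–Teitelbaum zero at the conductor-`8` character, `w(E₀ ⊗ χ₈) = −1` — and has a unit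
coefficient in degree `≤ 4` — a finite `2`-adic modular-symbol computation, numerically `λ = 4, μ = 0`,
kit j265726) and modularity (`hmod`: a newform exists, used once to bound the corank from above) give
`corank_{ℤ₂} Sel_{2^∞}(E₀/ℚ) = 3` AND `ord_{T=0} L₂(f, α₂; T) = 3` for every newform `f` of `E₀` — the
ORDER part of `2`-adic BSD for a rank-`3` curve, where classical BSD is unknown. Squeeze:
`3 ≤ rank ≤ corank ≤ ord ≤ 3` by `Rank2.paritySqueezeKernel`. Statement = p2's
`toy_corank_eq_order_eq_three` with `ToyFacts` DISCHARGED. [cite: Kato2004Asterisque, Thm. 17.4 and Thm. 18.4 (the divisibility corank ≤ ord at p = 2)] -/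
theorem toy_selmerCorank_eq_order_eq_three
    (hK : ∀ (hmin : (⟨1, 4, 0, 105, 0⟩ : WeierstrassCurve ℚ).IsGloballyMinimal) ⦃N : ℕ⦄ [NeZero N]
      (f : CuspForm (CongruenceSubgroup.Gamma0 N) 2),
      ModularForms.IsNewformOf (⟨1, 4, 0, 105, 0⟩ : WeierstrassCurve ℚ) f →
        (((⟨1, 4, 0, 105, 0⟩ : WeierstrassCurve ℚ).selmerCorank 2 : ℕ∞) ≤
          (padicLFunction f
            (@unitRoot (⟨1, 4, 0, 105, 0⟩ : WeierstrassCurve ℚ) hmin 2 _ : ℚ_[2])).order))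
    (hC : ∀ (hmin : (⟨1, 4, 0, 105, 0⟩ : WeierstrassCurve ℚ).IsGloballyMinimal) ⦃N : ℕ⦄ [NeZero N]
      (f : CuspForm (CongruenceSubgroup.Gamma0 N) 2),
      ModularForms.IsNewformOf (⟨1, 4, 0, 105, 0⟩ : WeierstrassCurve ℚ) f →
        ∃ (c : ℚ_[2]) (g : PowerSeries ℤ_[2]), c ≠ 0 ∧
          g.map (PadicInt.Coe.ringHom (p := 2)) =
            PowerSeries.C c * padicLFunction f
              (@unitRoot (⟨1, 4, 0, 105, 0⟩ : WeierstrassCurve ℚ) hmin 2 _ : ℚ_[2]) ∧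
          (PowerSeries.X + PowerSeries.C (2 : ℤ_[2])) ∣ g ∧ ∃ i ≤ 4, IsUnit (PowerSeries.coeff i g))
    (hmod : ∃ (N : ℕ) (_ : NeZero N) (f : CuspForm (CongruenceSubgroup.Gamma0 N) 2),
      ModularForms.IsNewformOf (⟨1, 4, 0, 105, 0⟩ : WeierstrassCurve ℚ) f) :
    (⟨1, 4, 0, 105, 0⟩ : WeierstrassCurve ℚ).selmerCorank 2 = 3 ∧
      ∀ (hmin : (⟨1, 4, 0, 105, 0⟩ : WeierstrassCurve ℚ).IsGloballyMinimal) ⦃N : ℕ⦄ [NeZero N]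
        (f : CuspForm (CongruenceSubgroup.Gamma0 N) 2),
        ModularForms.IsNewformOf (⟨1, 4, 0, 105, 0⟩ : WeierstrassCurve ℚ) f →
          (padicLFunction f
            (@unitRoot (⟨1, 4, 0, 105, 0⟩ : WeierstrassCurve ℚ) hmin 2 _ : ℚ_[2])).order = 3 := by
  haveI := toy_isElliptic
  have hmin₀ := toy_isGloballyMinimal
  have hrs := (⟨1, 4, 0, 105, 0⟩ : WeierstrassCurve ℚ).selmerCorank_eq_mordellWeilRank_add_holds 2
  have hr := toy_three_le_mordellWeilRank
  have hs3 : 3 ≤ (⟨1, 4, 0, 105, 0⟩ : WeierstrassCurve ℚ).selmerCorank 2 := by rw [hrs]; omega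
  -- `ord = 3` for every newform and every minimality witness
  have hord : ∀ (hmin : (⟨1, 4, 0, 105, 0⟩ : WeierstrassCurve ℚ).IsGloballyMinimal) ⦃N : ℕ⦄ [NeZero N]
      (f : CuspForm (CongruenceSubgroup.Gamma0 N) 2),
      ModularForms.IsNewformOf (⟨1, 4, 0, 105, 0⟩ : WeierstrassCurve ℚ) f →
        (padicLFunction f
          (@unitRoot (⟨1, 4, 0, 105, 0⟩ : WeierstrassCurve ℚ) hmin 2 _ : ℚ_[2])).order = 3 := by
    intro hmin N _ f hf
    obtain ⟨c, g, hc, hg, hdvd, hi⟩ := hC hmin f hf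
    have hlow : (3 : ℕ∞) ≤ (padicLFunction f
        (@unitRoot (⟨1, 4, 0, 105, 0⟩ : WeierstrassCurve ℚ) hmin 2 _ : ℚ_[2])).order :=
      le_trans (by exact_mod_cast hs3) (hK hmin f hf)
    exact paritySqueezeKernel _ c g hc hg hdvd hi hlow
  refine ⟨?_, hord⟩
  obtain ⟨N, hN, f, hf⟩ := hmod
  have h := hK hmin₀ f hf
  rw [hord hmin₀ f hf] at h
  have : (⟨1, 4, 0, 105, 0⟩ : WeierstrassCurve ℚ).selmerCorank 2 ≤ 3 := by exact_mod_cast h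
  omega


end Summit.BirchSwinnertonDyer.Rank2

end
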